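import Summits.Ventures.AbcSig.Rows.TemplateB
import Summits.Ventures.AbcSig.Rows.TemplateC

/-!
# Venture AbcSig — ROW TEMPLATE for `xⁿ + yⁿ = C z²` with `C = 2C'` EVEN squarefree ([BS04, Thm. 1.1] shape, case (ii))

HONEST FRAMING. Fully PROVED template theorem of a COMPUTATION cell (`pub-abcsig`); CONDITIONAL on named hypotheses,
no claim on ABC or any summit. For `C = 2C'` with `C'` odd squarefree, a primitive solution of `xⁿ + yⁿ = C z²` has
`x`, `y` odd (if one were even the left side would be odd), so by [BS04, Lemma 2.1/3.2] it falls in case (ii) with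
`ord₂(C) = 1` — `FreyCase.iiC` of `Recipes/BS04.lean`, `2`-exponent `8` — at the single level
`N = 2⁸ · C'² = 256·C'²` (e.g. `C = 2, 6, 10, 14`: `N = 256, 2304, 6400, 12544`, as in [BS04, §5]). GIVEN, for the
exponent `n` (prime, `≥ 7`, `n ∤ C'`): `BS04Package M` (cited), `DataComplete M N orbits` (computed) and per orbit a
kernel certificate or a cited exclusion for the family "`(1, 1, C)`, exponent `n`", the conclusion is
`¬ IsPrimitiveSolution 1 1 C n a b c` for `a·b ≠ ±1` (the census predicate `Rows.C1Cell` excludes `|xy| = 1`; for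
`C = 2`, `1 + 1 = 2·1²` IS a solution with `xy = 1`).

* `bs04OddLevel_one_one_twice` — the odd part of the Serre level for `(1, 1, 2C')` is `C'²`;
* `odd_ab_of_even_C` — `x`, `y` are odd;
* `row_template_evenC` — the row shape (via `no_solution_in_case` of `Rows/TemplateB.lean`).

Reference: [BS04] M. A. Bennett, C. M. Skinner, Canad. J. Math. 56 (2004) 23–54, §§2–5 (cases (i)–(v), Lemma 3.2).
-/

namespace Summit.Ventures.AbcSig

/-- For odd squarefree `C'` and `n ∤ C'`: the odd part of the Serre level for `(A, B, C) = (1, 1, 2C')` is `C'²`. -/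
theorem bs04OddLevel_one_one_twice (C' n : ℕ) (hsq : Squarefree C') (hodd : Odd C') (hnC : ¬ n ∣ C') :
    bs04OddLevel 1 1 (2 * C') n = C' ^ 2 := by
  have hC'0 : C' ≠ 0 := hodd.pos.ne'
  have hfilt : (2 * C').primeFactors.filter (fun p => p ≠ 2 ∧ p ≠ n) = C'.primeFactors := by
    ext p
    simp only [Finset.mem_filter, Nat.primeFactors_mul two_ne_zero hC'0, Finset.mem_union,
      Nat.prime_two.primeFactors, Finset.mem_singleton]
    constructor
    · rintro ⟨h | h, h2, -⟩
      · exact absurd h h2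
      · exact h
    · intro hp
      have hpd : p ∣ C' := Nat.dvd_of_mem_primeFactors hp
      refine ⟨Or.inr hp, ?_, ?_⟩
      · rintro rfl
        exact (Nat.not_even_iff_odd.mpr hodd) (even_iff_two_dvd.mpr hpd)
      · rintro rfl
        exact hnC hpd
  simp only [bs04OddLevel, hfilt, mul_one, Nat.primeFactors_one, Finset.filter_empty, Finset.prod_empty]
  rw [Finset.prod_pow, Nat.prod_primeFactors_of_squarefree hsq]

/-- Level for `(1, 1, 2C')` in case (ii)_C: `2⁸ · C'²`. -/
theorem bs04Level_one_one_twice (C' n : ℕ) (hsq : Squarefree C') (hodd : Odd C') (hnC : ¬ n ∣ C') :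
    bs04Level .iiC 1 1 (2 * C') n = 256 * C' ^ 2 := by
  simp only [bs04Level, FreyCase.twoExp, bs04OddLevel_one_one_twice C' n hsq hodd hnC]
  norm_num

/-- A primitive solution of `xⁿ + yⁿ = (2C') z²` (`n ≥ 1`) has `x·y` odd. -/
theorem odd_ab_of_even_C {C' n : ℕ} {a b c : ℤ} (hn : 1 ≤ n) (h : IsPrimitiveSolution 1 1 (2 * C') n a b c) :
    ¬ 2 ∣ a * b := by
  intro h2
  obtain ⟨heq, -, -, -, hab, -, -⟩ := h
  have hrhs : (2 : ℤ) ∣ (1 : ℕ) * a ^ n + (1 : ℕ) * b ^ n := by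
    rw [heq]; push_cast; exact Dvd.dvd.mul_right (Dvd.dvd.mul_right (dvd_refl 2) _) _
  simp only [Nat.cast_one, one_mul] at hrhs hab
  rcases Int.prime_two.dvd_mul.mp h2 with ha | hb
  · have hbn : (2 : ℤ) ∣ b ^ n := (dvd_add_right (dvd_pow ha (by omega))).mp hrhs
    have hb : (2 : ℤ) ∣ b := Int.prime_two.dvd_of_dvd_pow hbn
    have hu := hab.isUnit_of_dvd' ha hb
    rcases Int.isUnit_iff.mp hu with h | h <;> omega
  · have han : (2 : ℤ) ∣ a ^ n := (dvd_add_left (dvd_pow hb (by omega))).mp hrhs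
    have ha : (2 : ℤ) ∣ a := Int.prime_two.dvd_of_dvd_pow han
    have hu := hab.isUnit_of_dvd' ha hb
    rcases Int.isUnit_iff.mp hu with h | h <;> omega

/-- **Row template, `C = 2C'` even squarefree** (`C` and `C'` both given, `hC : C = 2 * C'`, so that rows state the
conclusion with the literal `C`). For odd squarefree `C'`, a prime `n ≥ 7` with `n ∤ C'`, and the
cell's hypotheses at level `256·C'²` for this `n` (package; data; per orbit a kernel certificate or a cited exclusion
for the family "`(1, 1, 2C')`, exponent `n`"), there is no primitive solution of `xⁿ + yⁿ = 2C' z²` with `xy ≠ ±1`. -/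
theorem row_template_evenC (C C' : ℕ) (hC : C = 2 * C') (hsq : Squarefree C') (hodd : Odd C') (M : NewformModel)
    (hP : M.BS04Package) {orbs : List OrbitData} (hD : M.DataComplete (256 * C' ^ 2) orbs) (n : ℕ) (hn : n.Prime)
    (h7 : 7 ≤ n) (hnC : ¬ n ∣ C')
    (hS : ∀ o ∈ orbs, (∀ e ∈ o.coeffs, e.ell.Prime ∧ e.ell ≠ 2 ∧ ¬ e.ell ∣ 256 * C' ^ 2) ∧
      (o.Eliminated bs04Allowed n ∨ M.Excludes (256 * C' ^ 2) o
        (fun S => S.A = 1 ∧ S.B = 1 ∧ S.C = C ∧ S.n = n)))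
    (a b c : ℤ) (h1 : a * b ≠ 1) (h2 : a * b ≠ -1) : ¬ IsPrimitiveSolution 1 1 C n a b c := by
  subst hC
  intro hsol
  have hC'pos : 0 < C' := hodd.pos
  have hab : ¬ 2 ∣ a * b := odd_ab_of_even_C (by omega) hsol
  have hord : OrdTwoEq (((2 * C' : ℕ) : ℤ)) 1 := by
    obtain ⟨k, hk⟩ := hodd
    refine ⟨⟨C', by push_cast; ring⟩, ?_⟩
    rintro ⟨m, hm⟩
    push_cast at hm
    omega
  have hcase : FreyCase.Holds .iiC 1 1 (2 * C') n a b c := ⟨hab, hord⟩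
  have hsqC : Squarefree (2 * C') := by
    rw [Nat.squarefree_mul]
    · exact ⟨Nat.prime_two.squarefree, hsq⟩
    · exact (Nat.coprime_two_left).mpr hodd
  have hndvd : ¬ n ∣ 1 * 1 * (2 * C') := by
    intro h
    rw [one_mul, one_mul] at h
    rcases (Nat.Prime.dvd_mul hn).mp h with h2 | hC
    · have := (Nat.prime_dvd_prime_iff_eq hn Nat.prime_two).mp h2
      omega
    · exact hnC hC
  have hfree : ∀ q : ℕ, q.Prime → ¬ q ^ n ∣ 1 ∧ ¬ q ^ n ∣ 1 := by
    intro q hq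
    have : ¬ q ^ n ∣ 1 := by
      intro h
      have h1 := Nat.dvd_one.mp h
      rw [Nat.pow_eq_one] at h1
      rcases h1 with h1 | h1
      · exact hq.one_lt.ne' h1
      · omega
    exact ⟨this, this⟩
  exact no_solution_in_case M hP ⟨1, 1, 2 * C', n, a, b, c⟩ .iiC (256 * C' ^ 2) one_pos one_pos (by positivity)
    hsqC hn h7 hndvd hfree hsol h1 h2 hcase (bs04Level_one_one_twice C' n hsq hodd hnC) hD
    (fun S => S.A = 1 ∧ S.B = 1 ∧ S.C = 2 * C' ∧ S.n = n) ⟨rfl, rfl, rfl, rfl⟩ hS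

end Summit.Ventures.AbcSig
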